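import Mathlib.Topology.Algebra.IsUniformGroup.Basic
import Mathlib.Topology.Algebra.ConstMulAction
import Mathlib.Topology.Algebra.InfiniteSum.Module
import Mathlib.Topology.Algebra.Group.Quotient
import Mathlib.Analysis.Complex.Basic

/-!
# T5AutomorphizeContinuous — the automorphization `Σ_γ f(xγ)` of `f ∈ C_c(G)` along a discrete
subgroup is a locally finite sum, continuous and `Γ`-invariant ([DE] Lemma 9.2.3, first half)

Cell pub-hodge-repro2, seat p5, Tier 5 (route/T5-N4-p5.md, N4.3 v13 (B1)–(B2)).  [DE] Lemma 9.2.3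
writes `η(f)` on `L²(Γ\G)` as an integral operator whose kernel is the automorphization
`k(x, y) = Σ_{γ ∈ Γ} f(x⁻¹ γ y)` — a sum that is LOCALLY FINITE because `Γ` is discrete and `f` has
compact support, hence a continuous function on the quotient.  This file is that local finiteness
and continuity, Mathlib-only, in Mathlib's conventions (left cosets `G ⧸ Γ`, `Γ` acting on the
right through `Γ.op`, `QuotientGroup.automorphize f (x : G ⧸ Γ) = ∑' γ : Γ.op, f (γ • x)`):

* `properlyDiscontinuousSMul_op`: a discrete subgroup of a Hausdorff topological group acts
  properly discontinuously on the right (Mathlib's `Subgroup.tendsto_coe_cofinite_of_discrete` +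
  `Subgroup.properlyDiscontinuousSMul_opposite_of_tendsto_cofinite`);
* `finite_setOf_exists_smul_mem` / `autoFun_eq_sum_on`: **local finiteness** — on a compact `L`
  only finitely many `γ` contribute, and `autoFun Γ f x := ∑' γ : Γ.op, f (γ • x)` is a FINITE sum
  there;
* `continuous_autoFun`: **continuity** of the automorphization on `G` (locally a finite sum of
  continuous functions; `G` weakly locally compact);
* `autoFun_mul_mem`: **`Γ`-invariance** `autoFun Γ f (x * γ) = autoFun Γ f x` (reindexing the sum);
* `continuous_automorphize`: **continuity on the quotient** of Mathlib's
  `QuotientGroup.automorphize f : G ⧸ Γ → ℂ` (the quotient map is open).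

The second half of Lemma 9.2.3 (the two-variable kernel on `(G ⧸ Γ) × (G ⧸ Γ)` and the identity
`η(f) = integralOp` through Mathlib's unfolding trick) is the next row.  Mathlib only.  Axioms:
propext, Classical.choice, Quot.sound.  README §8(d): uses an L-value-free non-vanishing device: NO.
-/

namespace Summit.Ventures.HodgeRepro2.T5AutomorphizeContinuous

open Filter Topology Set

variable {G : Type*} [Group G] [TopologicalSpace G] [IsTopologicalGroup G]

/-! ### The automorphization on `G` -/

/-- The automorphization of `f` along `Γ`, on `G` itself: `x ↦ ∑' γ : Γ.op, f (γ • x)`, i.e.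
`Σ_{γ ∈ Γ} f (x * γ)`. -/
noncomputable def autoFun (Γ : Subgroup G) (f : G → ℂ) : G → ℂ :=
  fun x => ∑' γ : Γ.op, f (γ • x)

omit [TopologicalSpace G] [IsTopologicalGroup G] in
/-- Mathlib's `QuotientGroup.automorphize f` on the class of `x` is `autoFun Γ f x`. -/
theorem automorphize_mk (Γ : Subgroup G) (f : G → ℂ) (x : G) :
    QuotientGroup.automorphize f (x : G ⧸ Γ) = autoFun Γ f x :=
  rfl

omit [TopologicalSpace G] [IsTopologicalGroup G] in
/-- The right action of `Γ.op` on `G`: `γ • x = x * γ`. -/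
theorem op_smul_apply {Γ : Subgroup G} (γ : Γ.op) (x : G) : γ • x = x * (γ : Gᵐᵒᵖ).unop := by
  rw [Subgroup.smul_def, MulOpposite.smul_eq_mul_unop]

/-- A discrete subgroup of a Hausdorff topological group acts properly discontinuously on the
right. -/
theorem properlyDiscontinuousSMul_op [T2Space G] (Γ : Subgroup G) [DiscreteTopology Γ] :
    ProperlyDiscontinuousSMul Γ.op G :=
  Subgroup.properlyDiscontinuousSMul_opposite_of_tendsto_cofinite Γ
    (Subgroup.tendsto_coe_cofinite_of_discrete Γ (isDiscrete_iff_discreteTopology.2 inferInstance))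

variable {Γ : Subgroup G}

/-! ### Local finiteness -/

omit [IsTopologicalGroup G] in
/-- **Local finiteness**: for a compact `L` and a compactly supported `f`, only finitely many
`γ ∈ Γ.op` have `f (γ • x) ≠ 0` for some `x ∈ L`. -/
theorem finite_setOf_exists_smul_mem [ProperlyDiscontinuousSMul Γ.op G] {f : G → ℂ}
    (hf : HasCompactSupport f) {L : Set G} (hL : IsCompact L) :
    {γ : Γ.op | ∃ x ∈ L, f (γ • x) ≠ 0}.Finite := by
  refine (ProperlyDiscontinuousSMul.finite_disjoint_inter_image hL hf).subset ?_
  rintro γ ⟨x, hxL, hx⟩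
  exact ⟨γ • x, ⟨x, hxL, rfl⟩, subset_tsupport f hx⟩

omit [IsTopologicalGroup G] in
/-- On a compact `L`, `autoFun Γ f` is the FINITE sum over the contributing `γ`. -/
theorem autoFun_eq_sum_on [ProperlyDiscontinuousSMul Γ.op G] {f : G → ℂ}
    (hf : HasCompactSupport f) {L : Set G} (hL : IsCompact L) {x : G} (hx : x ∈ L) :
    autoFun Γ f x = ∑ γ ∈ (finite_setOf_exists_smul_mem (Γ := Γ) hf hL).toFinset, f (γ • x) := by
  unfold autoFun
  refine tsum_eq_sum fun γ hγ => ?_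
  by_contra h
  exact hγ ((finite_setOf_exists_smul_mem (Γ := Γ) hf hL).mem_toFinset.2 ⟨x, hx, h⟩)

/-- Each translate `x ↦ f (γ • x)` is continuous. -/
theorem continuous_smul_comp {f : G → ℂ} (hfc : Continuous f) (γ : Γ.op) :
    Continuous fun x => f (γ • x) := by
  have h : (fun x => f (γ • x)) = fun x => f (x * (γ : Gᵐᵒᵖ).unop) :=
    funext fun x => by rw [op_smul_apply]
  rw [h]
  exact hfc.comp (continuous_mul_const _)

/-! ### Continuity and invariance -/

/-- **Continuity of the automorphization** of `f ∈ C_c(G)` on `G` (`Γ.op` properly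
discontinuous, `G` weakly locally compact): near every point it is a finite sum of continuous
functions. -/
theorem continuous_autoFun [WeaklyLocallyCompactSpace G] [ProperlyDiscontinuousSMul Γ.op G]
    {f : G → ℂ} (hfc : Continuous f) (hfs : HasCompactSupport f) :
    Continuous (autoFun Γ f) := by
  rw [continuous_iff_continuousAt]
  intro x₀
  obtain ⟨L, hL, hLx⟩ := exists_compact_mem_nhds x₀
  have hsum : Continuous fun x =>
      ∑ γ ∈ (finite_setOf_exists_smul_mem (Γ := Γ) hfs hL).toFinset, f (γ • x) :=
    continuous_finsetSum _ fun γ _ => continuous_smul_comp hfc γ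
  refine hsum.continuousAt.congr ?_
  filter_upwards [hLx] with x hx
  exact (autoFun_eq_sum_on hfs hL hx).symm

omit [TopologicalSpace G] [IsTopologicalGroup G] in
/-- **`Γ`-invariance**: `autoFun Γ f (x * γ) = autoFun Γ f x` for `γ ∈ Γ` (reindex the sum by
`δ ↦ δ * op γ`). -/
theorem autoFun_mul_mem (f : G → ℂ) (x : G) {γ : G} (hγ : γ ∈ Γ) :
    autoFun Γ f (x * γ) = autoFun Γ f x := by
  unfold autoFun
  set g : Γ.op := ⟨MulOpposite.op γ, Subgroup.mem_op.2 (by simpa using hγ)⟩ with hg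
  have hgx : g • x = x * γ := by
    rw [op_smul_apply]
    rfl
  have := (Equiv.mulRight g).tsum_eq fun δ : Γ.op => f (δ • x)
  simpa only [Equiv.coe_mulRight, mul_smul, hgx] using this

/-- **Continuity on the quotient**: Mathlib's `QuotientGroup.automorphize f : G ⧸ Γ → ℂ` is
continuous for `f ∈ C_c(G)` (the quotient map `G → G ⧸ Γ` is open). -/
theorem continuous_automorphize [WeaklyLocallyCompactSpace G] [ProperlyDiscontinuousSMul Γ.op G]
    {f : G → ℂ} (hfc : Continuous f) (hfs : HasCompactSupport f) :
    Continuous (QuotientGroup.automorphize f : G ⧸ Γ → ℂ) := by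
  rw [QuotientGroup.isOpenQuotientMap_mk.isQuotientMap.continuous_iff]
  exact continuous_autoFun hfc hfs

/-- The same for a DISCRETE subgroup of a Hausdorff, weakly locally compact group (the proper
discontinuity supplied by `properlyDiscontinuousSMul_op`). -/
theorem continuous_automorphize_of_discrete [T2Space G] [WeaklyLocallyCompactSpace G]
    [DiscreteTopology Γ] {f : G → ℂ} (hfc : Continuous f) (hfs : HasCompactSupport f) :
    Continuous (QuotientGroup.automorphize f : G ⧸ Γ → ℂ) :=
  haveI := properlyDiscontinuousSMul_op Γ
  continuous_automorphize hfc hfs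

end Summit.Ventures.HodgeRepro2.T5AutomorphizeContinuous
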